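import Mathlib
import Literature.NumberTheory.Sieve.BatemanHorn
import HarnessLib

/-!
# Route `AlmostPrimeZeros`, crux `SystemLSDRealSegment` (stmt-Parity-11292):
# vocabulary of the line `beta-thinned-root-kernel`

Route-posited objects (D-0016 `<Route>Defs` file) shared by the registered stubs of the checked
skeleton `Cruxes/SystemLSDRealSegment/Lines/beta-thinned-root-kernel.lean` and by the crux file that
composes them.  Nothing is asserted: plain definitions over Mathlib and
`Literature.NumberTheory.Sieve` (`polyRootCountMod`, `batemanHornConst`), plus three calibration
identities with one-line proofs.

The crux asks, for a Bateman–Horn system `f = (f₁,…,f_k)`, for the real-segment law of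
`x⁻¹ (log x)^{k(1−y)} Σ_{n≤x} y^{s_f(n)}`, `s_f(n) = Σᵢ Σ_{p^v ∥ fᵢ(n)} min(v,2)`.  The line
Möbius-expands the tilt: `y^{s(m)} = Σ_{d ∣ m} h_y(d)` with the THINNED DIVISOR WEIGHT `h_y`
(`thinWeight`: multiplicative, `h_y(p) = y − 1`, `h_y(p²) = y² − y`, `h_y(p^v) = 0` for `v ≥ 3`), sums
over divisor TUPLES `d = (dᵢ)`, `dᵢ ∣ fᵢ(n)` (`tuples`), and cuts at the trivial level `∏ dᵢ ≤ x`: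
`typeISum` (level `≤ x`) + `kernelSum` (beyond).  The explicit Euler factor `eulerFactor f = λ_f`
(ordered product of the local tilted means `localFactor f p`) is the `Λ` of the crux.  The Type-I
part is organised through the tuple densities `tupleDens` (complete residue systems, CRT) and the
multiplicative coefficient `bCoeff f y m = Σ_{∏dᵢ = m} ∏ h_y(dᵢ)·δ_f(d)`.

References: line card `Cruxes/SystemLSDRealSegment/Lines/beta-thinned-root-kernel.md`;
H. Halberstam, H.-E. Richert, *Sieve Methods* (1974) Lemma 5.4; G. Tenenbaum, *Introduction to
analytic and probabilistic number theory* (2015) II.5–II.6.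
-/

open Filter Finset Polynomial
open scoped BigOperators Topology

namespace Summit.Parity.BatemanHorn.Cruxes.SystemLSDRealSegment.BetaThinnedRootKernel

open Literature.NumberTheory.Sieve

noncomputable section

section Weights

variable {R : Type*} [CommRing R]

/-- The capped statistic `s(m) = Σ_{p^v ∥ m} min(v, 2)` (verbatim the crux's inner sum; `s(0) = 0`).
[folklore] -/
def capped (m : ℕ) : ℕ := m.factorization.sum fun _ v => min v 2

/-- Local coefficients of the thinned weight `h_y`: `h_y(p⁰) = 1`, `h_y(p) = y − 1`, `h_y(p²) = y² − y`,
`h_y(p^v) = 0` for `v ≥ 3` (the Möbius transform of `v ↦ y^{min(v,2)}`; all `≥ 0` for real `y ≥ 1`).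
[folklore] -/
def thinCoeff (y : R) : ℕ → R
  | 0 => 1
  | 1 => y - 1
  | 2 => y ^ 2 - y
  | _ => 0

/-- `h_y(p⁰) = 1`. [folklore] -/
@[simp] theorem thinCoeff_zero (y : R) : thinCoeff y 0 = 1 := rfl

/-- `h_y(p) = y − 1`. [folklore] -/
@[simp] theorem thinCoeff_one (y : R) : thinCoeff y 1 = y - 1 := rfl

/-- `h_y(p²) = y² − y`. [folklore] -/
@[simp] theorem thinCoeff_two (y : R) : thinCoeff y 2 = y ^ 2 - y := rfl

/-- `h_y(p^v) = 0` for `v ≥ 3` (the cap). [folklore] -/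
theorem thinCoeff_of_three_le (y : R) {v : ℕ} (hv : 3 ≤ v) : thinCoeff y v = 0 := by
  obtain ⟨w, rfl⟩ := Nat.exists_eq_add_of_le hv
  rw [show 3 + w = w + 3 by omega]
  rfl

/-- The THINNED DIVISOR WEIGHT `h_y(d) = ∏_{p^v ∥ d} thinCoeff y v`: multiplicative, supported on the
cube-free `d`; `y^{s(m)} = Σ_{d ∣ m} h_y(d)`.  (`h_y(0) = 1` is junk, never summed.) [folklore] -/
def thinWeight (y : R) (d : ℕ) : R := d.factorization.prod fun _ v => thinCoeff y v

/-- `h_y(1) = 1`. [folklore] -/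
theorem thinWeight_one (y : R) : thinWeight y 1 = 1 := by simp [thinWeight]

/-- `h_y(p^j) = thinCoeff y j`. [folklore] -/
theorem thinWeight_prime_pow (y : R) {p : ℕ} (hp : p.Prime) (j : ℕ) :
    thinWeight y (p ^ j) = thinCoeff y j := by
  rw [thinWeight, hp.factorization_pow, Finsupp.prod_single_index]
  exact thinCoeff_zero y

/-- `h_y(p) = y − 1`. [folklore] -/
theorem thinWeight_prime (y : R) {p : ℕ} (hp : p.Prime) : thinWeight y p = y - 1 := by
  simpa using thinWeight_prime_pow y hp 1

/-- `h_y` is multiplicative on coprime arguments. [folklore] -/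
theorem thinWeight_mul (y : R) {m n : ℕ} (hm : m ≠ 0) (hn : n ≠ 0) (h : m.Coprime n) :
    thinWeight y (m * n) = thinWeight y m * thinWeight y n := by
  unfold thinWeight
  rw [Nat.factorization_mul hm hn, Finsupp.prod_add_index_of_disjoint]
  simpa only [Nat.support_factorization] using h.disjoint_primeFactors

/-- `h_y(d)` over `ℂ` at a real `y` is the real weight cast. [folklore] -/
theorem thinWeight_ofReal (y : ℝ) (d : ℕ) : thinWeight (y : ℂ) d = ((thinWeight y d : ℝ) : ℂ) := by
  unfold thinWeight Finsupp.prod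
  rw [Complex.ofReal_prod]
  refine Finset.prod_congr rfl fun p _ => ?_
  show thinCoeff (y : ℂ) (d.factorization p) = ((thinCoeff y (d.factorization p) : ℝ) : ℂ)
  rcases Nat.lt_or_ge (d.factorization p) 3 with h | h
  · interval_cases (d.factorization p) <;>
      simp only [thinCoeff_zero, thinCoeff_one, thinCoeff_two, Complex.ofReal_one, Complex.ofReal_sub,
        Complex.ofReal_pow]
  · rw [thinCoeff_of_three_le _ h, thinCoeff_of_three_le _ h, Complex.ofReal_zero]

end Weights

/-! ### Divisor tuples, the Type-I sum and the beyond-level kernel -/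

/-- Divisors with the convention `0 ↦ {1}`: the crux sends a value `fᵢ(n) ≤ 0` to `toNat = 0`, whose
statistic is `0 = s(1)`; with `divSet 0 = {1}` the expansion `y^{s(m)} = Σ_{d ∈ divSet m} h_y(d)` is
exact for EVERY `m : ℕ`. [folklore] -/
def divSet (m : ℕ) : Finset ℕ := (max m 1).divisors

/-- The divisor TUPLES of the values at `n`: `d = (dᵢ)`, `dᵢ ∈ divSet (fᵢ(n)).toNat`. [folklore] -/
def tuples {k : ℕ} (f : Fin k → ℤ[X]) (n : ℕ) : Finset (Fin k → ℕ) :=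
  Fintype.piFinset fun i => divSet ((f i).eval (n : ℤ)).toNat

/-- TYPE-I PART `T_x(y) = Σ_{0≤n≤x} Σ_{d ∈ tuples f n, ∏ dᵢ ≤ x} ∏ᵢ h_y(dᵢ)` (real). [folklore] -/
def typeISum {k : ℕ} (f : Fin k → ℤ[X]) (y : ℝ) (x : ℕ) : ℝ :=
  ∑ n ∈ range (x + 1), ∑ d ∈ (tuples f n).filter (fun d => ∏ i, d i ≤ x), ∏ i, thinWeight y (d i)

/-- BEYOND-LEVEL KERNEL `K_x(y) = Σ_{0≤n≤x} Σ_{d ∈ tuples f n, x < ∏ dᵢ} ∏ᵢ h_y(dᵢ)` (real).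
[folklore] -/
def kernelSum {k : ℕ} (f : Fin k → ℤ[X]) (y : ℝ) (x : ℕ) : ℝ :=
  ∑ n ∈ range (x + 1), ∑ d ∈ (tuples f n).filter (fun d => x < ∏ i, d i), ∏ i, thinWeight y (d i)

/-! ### Local and global Euler factors -/

/-- Capped `p`-adic order of an integer read modulo `p²`: `2` if `p² ∣ m`, `1` if `p ∣ m`, else `0`.
[folklore] -/
def localExp (p : ℕ) (m : ℤ) : ℕ :=
  if (p : ℤ) ^ 2 ∣ m then 2 else if (p : ℤ) ∣ m then 1 else 0

/-- LOCAL FACTOR `E_p(z) = p⁻² Σ_{n mod p²} z^{Σᵢ localExp p (fᵢ(n))}` — the `p`-adic expectation of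
`z^{s_{f,p}}`: a polynomial in `z` of degree `≤ 2k`, `E_p(0) = 1 − ω_f(p)/p`, `E_p(1) = 1`. [folklore] -/
def localFactor {k : ℕ} (f : Fin k → ℤ[X]) (p : ℕ) (z : ℂ) : ℂ :=
  ((p : ℂ) ^ 2)⁻¹ * ∑ n ∈ range (p ^ 2), z ^ (∑ i, localExp p ((f i).eval (n : ℤ)))

/-- THE EXPLICIT EULER FACTOR `λ_f(z) = lim_N ∏_{p ≤ N} E_p(z)·(1 − 1/p)^{k(z−1)}` (ordered product,
as `batemanHornConst`; `(1−1/p)^{k(z−1)} = exp(k(z−1) log(1−1/p))`; junk if the limit does not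
exist). [folklore] -/
def eulerFactor {k : ℕ} (f : Fin k → ℤ[X]) (z : ℂ) : ℂ :=
  limUnder atTop fun N : ℕ => ∏ p ∈ Nat.primesLE N,
    localFactor f p z * Complex.exp ((k : ℂ) * (z - 1) * (Real.log (1 - 1 / (p : ℝ)) : ℂ))

/-- Calibration `E_p(1) = 1`. [folklore] -/
theorem localFactor_one {k : ℕ} (f : Fin k → ℤ[X]) {p : ℕ} (hp : p.Prime) : localFactor f p 1 = 1 := by
  have hp0 : (p : ℂ) ≠ 0 := by exact_mod_cast hp.ne_zero
  simp only [localFactor, one_pow, Finset.sum_const, Finset.card_range, nsmul_eq_mul, mul_one]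
  push_cast
  exact inv_mul_cancel₀ (pow_ne_zero 2 hp0)

/-- Calibration `λ_f(1) = 1` for EVERY family. [folklore] -/
theorem eulerFactor_one {k : ℕ} (f : Fin k → ℤ[X]) : eulerFactor f 1 = 1 := by
  unfold eulerFactor
  have : (fun N : ℕ => ∏ p ∈ Nat.primesLE N,
      localFactor f p 1 * Complex.exp ((k : ℂ) * (1 - 1) * (Real.log (1 - 1 / (p : ℝ)) : ℂ))) =
      fun _ => 1 := by
    funext N
    refine Finset.prod_eq_one fun p hp => ?_
    rw [localFactor_one f (Nat.mem_primesLE.1 hp).2, sub_self, mul_zero, zero_mul,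
      Complex.exp_zero, mul_one]
  rw [this]
  exact tendsto_const_nhds.limUnder_eq

/-- **stub_defsCalibration** — registered bookkeeping stub of the skeleton (the calibration
`λ_f(1) = 1` for every family, by name, through which this vocabulary file lands `--supports`). [folklore] -/
theorem stub_defsCalibration : ∀ (k : ℕ) (f : Fin k → ℤ[X]), eulerFactor f 1 = 1 :=
  fun _ f => eulerFactor_one f

/-! ### Tuple densities and the Type-I coefficient `b` -/

/-- Tuples of positive integers with product EXACTLY `m` (as tuples of divisors of `m`; empty for
`m = 0`). [folklore] -/
def prodTuples (k m : ℕ) : Finset (Fin k → ℕ) :=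
  (Fintype.piFinset fun _ : Fin k => m.divisors).filter fun d => ∏ i, d i = m

/-- The period `lcm(d₁,…,d_k)` of the tuple condition `dᵢ ∣ fᵢ(n) ∀ i` (`= 1` for the empty tuple).
[folklore] -/
def tupleLcm {k : ℕ} (d : Fin k → ℕ) : ℕ := Finset.univ.lcm d

/-- `c_f(d) = #{n mod lcm d : dᵢ ∣ fᵢ(n) for every i}` — solutions of the tuple congruence in one
period. [folklore] -/
def tupleCount {k : ℕ} (f : Fin k → ℤ[X]) (d : Fin k → ℕ) : ℕ :=
  #((range (tupleLcm d)).filter fun n : ℕ => ∀ i, ((d i : ℕ) : ℤ) ∣ (f i).eval (n : ℤ))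

/-- The tuple density `δ_f(d) = c_f(d)/lcm(d)` (CRT-multiplicative in `d`). [folklore] -/
def tupleDens {k : ℕ} (f : Fin k → ℤ[X]) (d : Fin k → ℕ) : ℝ :=
  (tupleCount f d : ℝ) / (tupleLcm d : ℝ)

/-- THE TYPE-I COEFFICIENT `b_{f,y}(m) = Σ_{d : ∏dᵢ = m} ∏ᵢ h_y(dᵢ)·δ_f(d)`: non-negative and
multiplicative for `y ≥ 1`, `b(1) = 1`, `b(p) = (y−1)Σᵢρᵢ(p)/p`, `Σ_ν b(p^ν) = E_p(y)`, and
`T_x(y) = (x+1)Σ_{m≤x} b(m) +` (error). [folklore] -/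
def bCoeff {k : ℕ} (f : Fin k → ℤ[X]) (y : ℝ) (m : ℕ) : ℝ :=
  ∑ d ∈ prodTuples k m, (∏ i, thinWeight y (d i)) * tupleDens f d

/-! ### Statements of the line (the registered stub goals, as named predicates)

All statements are PREDICATES of the family / polynomial / function they speak about (the stubs quantify
over the parameters), so that each can be instantiated, landed and cited one case at a time. -/

/-- **EulerFactorClause k f**: if `f` is a Bateman–Horn system, `λ_f = eulerFactor f` is holomorphic on
`|z| < 2` and `λ_f(0) = batemanHornConst f`. [folklore] -/
def EulerFactorClause (k : ℕ) (f : Fin k → ℤ[X]) : Prop :=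
  IsBatemanHornSystem f →
    DifferentiableOn ℂ (eulerFactor f) (Metric.ball 0 2) ∧ eulerFactor f 0 = (batemanHornConst f : ℂ)

/-- **RootMertens g** (Landau 1903: Mertens' first theorem for the roots of a polynomial congruence):
if `g ∈ ℤ[X]` is irreducible and non-constant, `|Σ_{p ≤ Q} ρ_g(p) log p / p − log Q| ≤ C_g` for all
`Q ≥ 2`, `ρ_g(p) = polyRootCountMod ![g] p`. [folklore] -/
def RootMertens (g : ℤ[X]) : Prop :=
  Irreducible g → 0 < g.natDegree →
    ∃ C : ℝ, ∀ Q : ℕ, 2 ≤ Q →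
      |(∑ p ∈ Nat.primesLE Q, (polyRootCountMod ![g] p : ℝ) * Real.log p / p) - Real.log Q| ≤ C

/-- **LocalCounts k f** (the local inputs of a Bateman–Horn system at all large primes `p`): `p ∤ lc fᵢ`;
no common root of two members mod `p` (resultants, Bateman–Horn 1962 p. 364); and Hensel: at most
`deg fᵢ` residues `n mod p²` with `p² ∣ fᵢ(n)` (simple roots lift uniquely for `p ∤ Res(fᵢ, fᵢ′)`).
[folklore] -/
def LocalCounts (k : ℕ) (f : Fin k → ℤ[X]) : Prop :=
  IsBatemanHornSystem f →
    ∃ P₀ : ℕ, ∀ p : ℕ, p.Prime → P₀ < p →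
      (∀ i, ¬ (p : ℤ) ∣ (f i).leadingCoeff) ∧
      (∀ i j, i ≠ j → ∀ n : ℤ, ¬ ((p : ℤ) ∣ (f i).eval n ∧ (p : ℤ) ∣ (f j).eval n)) ∧
      (∀ i, #((range (p ^ 2)).filter fun n : ℕ => ((p : ℤ) ^ 2) ∣ (f i).eval (n : ℤ)) ≤ (f i).natDegree)

/-- **LevinFainleibAsymp g κ** (the logarithmic mean-value theorem for non-negative multiplicative
functions, asymptotic form with identified constant; Levin–Faĭnleĭb 1967, Halberstam–Richert 1974
Lemma 5.4, Ramaré 2022 Thm 13.3): `g ≥ 0` multiplicative, `κ ≥ 0`,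
(H1) `|Σ_{p ≤ Q} g(p) log p − κ log Q| ≤ L` (`Q ≥ 2`), (H2) `Σ_p g(p)² log p + Σ_p Σ_{ν≥2} g(p^ν) log p^ν ≤ A`
(bounded partial sums) ⇒ the ordered product `P = ∏_p (Σ_ν g(p^ν))(1 − 1/p)^κ` converges and
`Σ_{d ≤ D} g(d) ~ (P/Γ(κ+1)) (log D)^κ`. (Karamata/Hardy–Littlewood Tauberian route: the Dirichlet
series `Σ g(d)d^{−s} ∼ P s^{−κ}` as `s → 0⁺`.) [folklore] -/
def LevinFainleibAsymp (g : ℕ → ℝ) (κ : ℝ) : Prop :=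
  0 ≤ κ → (∀ n, 0 ≤ g n) → g 1 = 1 →
    (∀ m n : ℕ, m.Coprime n → g (m * n) = g m * g n) →
    (∃ L : ℝ, ∀ Q : ℕ, 2 ≤ Q →
      |(∑ p ∈ Nat.primesLE Q, g p * Real.log p) - κ * Real.log Q| ≤ L) →
    (∃ A : ℝ, ∀ N : ℕ,
      (∑ p ∈ Nat.primesLE N, g p ^ 2 * Real.log p) +
        (∑ p ∈ Nat.primesLE N, ∑ ν ∈ Icc 2 N, g (p ^ ν) * Real.log ((p : ℝ) ^ ν)) ≤ A) →
    ∃ P : ℝ,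
      Tendsto (fun N : ℕ => ∏ p ∈ Nat.primesLE N, (∑' ν : ℕ, g (p ^ ν)) * (1 - 1 / (p : ℝ)) ^ κ)
        atTop (𝓝 P) ∧
      Tendsto (fun D : ℕ => (∑ d ∈ Icc 1 D, g d) / Real.log D ^ κ) atTop
        (𝓝 (P / Real.Gamma (κ + 1)))

/-- **TypeISandwich k f y** (Fubini over divisor tuples + complete residue systems; the level `∏dᵢ ≤ x`
is free): `|T_x(y) − (x+1) Σ_{m≤x} b(m)| ≤ C (1 + Σ_{m≤x} m·b(m))`. [folklore] -/
def TypeISandwich (k : ℕ) (f : Fin k → ℤ[X]) (y : ℝ) : Prop :=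
  ∃ C : ℝ, ∀ x : ℕ,
    |typeISum f y x - ((x : ℝ) + 1) * ∑ m ∈ Icc 1 x, bCoeff f y m| ≤
      C * (1 + ∑ m ∈ Icc 1 x, (m : ℝ) * bCoeff f y m)

/-- **TypeILocal k f y** (structure of `b = bCoeff f y`): non-negative, `b(1) = 1`, multiplicative on
coprime arguments (CRT), `b(p) = (y−1)Σᵢρᵢ(p)/p` at every prime, `b(p^ν) = 0` for `ν > 2k`,
`b(p^ν) ≤ C/p²` for `2 ≤ ν` at all large `p`, and `Σ_{ν ≤ 2k} b(p^ν) = E_p(y)`. [folklore] -/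
def TypeILocal (k : ℕ) (f : Fin k → ℤ[X]) (y : ℝ) : Prop :=
  (∀ m, 0 ≤ bCoeff f y m) ∧ bCoeff f y 1 = 1 ∧
  (∀ m n : ℕ, m.Coprime n → bCoeff f y (m * n) = bCoeff f y m * bCoeff f y n) ∧
  (∀ p : ℕ, p.Prime → bCoeff f y p = (y - 1) * ∑ i, (polyRootCountMod ![f i] p : ℝ) / p) ∧
  (∀ p : ℕ, p.Prime → ∀ ν : ℕ, 2 * k < ν → bCoeff f y (p ^ ν) = 0) ∧
  (∃ P₀ : ℕ, ∃ C : ℝ, ∀ p : ℕ, p.Prime → P₀ < p → ∀ ν : ℕ, 2 ≤ ν →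
    bCoeff f y (p ^ ν) ≤ C / (p : ℝ) ^ 2) ∧
  (∀ p : ℕ, p.Prime →
    localFactor f p (y : ℂ) = ((∑ ν ∈ range (2 * k + 1), bCoeff f y (p ^ ν) : ℝ) : ℂ))

/-- **TypeILaw k f y** (the level-`x` half of the real-segment law):
`x⁻¹ (log x)^{k(1−y)} T_x(y) → λ_f(y)/Γ(k(y−1)+1)`, normaliser written exactly as in the crux
(claimed by the stubs for every Bateman–Horn system `f` and every real `y > 1`). [folklore] -/
def TypeILaw (k : ℕ) (f : Fin k → ℤ[X]) (y : ℝ) : Prop :=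
  Tendsto (fun x : ℕ => (x : ℂ)⁻¹ * Complex.exp ((k : ℂ) * (1 - (y : ℂ)) * (Real.log (Real.log x) : ℂ)) *
      (typeISum f y x : ℂ)) atTop
    (𝓝 (eulerFactor f y * (Complex.Gamma ((k : ℂ) * ((y : ℂ) - 1) + 1))⁻¹))

/-- **BetaKernelLaw k f y** (the beyond-level half; OPEN on the crux's segment):
`x⁻¹ (log x)^{k(1−y)} K_x(y) → λ_f(y)·(D^{y−1}Γ(y)^{−k} − Γ(k(y−1)+1)^{−1})`, `D = ∏ deg fᵢ`.
[folklore] -/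
def BetaKernelLaw (k : ℕ) (f : Fin k → ℤ[X]) (y : ℝ) : Prop :=
  Tendsto (fun x : ℕ => (x : ℂ)⁻¹ * Complex.exp ((k : ℂ) * (1 - (y : ℂ)) * (Real.log (Real.log x) : ℂ)) *
      (kernelSum f y x : ℂ)) atTop
    (𝓝 (eulerFactor f y *
      (Complex.exp (((y : ℂ) - 1) * (Real.log (∏ i, ((f i).natDegree : ℝ)) : ℂ)) * (Complex.Gamma y)⁻¹ ^ k -
        (Complex.Gamma ((k : ℂ) * ((y : ℂ) - 1) + 1))⁻¹)))

end

end Summit.Parity.BatemanHorn.Cruxes.SystemLSDRealSegment.BetaThinnedRootKernel
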